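import Literature.NumberTheory.Automorphic.PAdicReps
import Literature.NumberTheory.Automorphic.SatakeParametersGLProofs
import Literature.NumberTheory.Automorphic.SatakeParametersGLGelfandPairProofs
import Literature.NumberTheory.Automorphic.SatakeParametersGLIsoProofs
import Literature.NumberTheory.Automorphic.SymmLaurentWeylInvariants
import HarnessLib

/-!
# lang.S17 for `GL_n` over a non-archimedean local field: discharges

Topic `NumberTheory/Automorphic`.  A *proofs* file (theorems only, no definition, no named fact)
next to `PAdicReps`, which restates for `G = GL_n(F)`, `K₀ = GL_n(𝒪_F) = glInt n F` the
**lang.S17** block of the Langlands family (Satake 1963; Cartier, *Representations of 𝔭-adic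
groups: a survey*, Corvallis 1979, §IV) as the named facts `PAdicReps.satake_gl`,
`PAdicReps.satakeIsomorphismStatement_gl`, `PAdicReps.isGelfandPair_glInt`,
`PAdicReps.existsUnique_isSatakeParameter`.  Each of them is *literally* the corresponding fact of
module `SatakeParametersGL` (same Lean statement under the `PAdicReps.` prefix), so each is
discharged by the discharge of its `SatakeParametersGL` twin:

* `PAdicReps.isGelfandPair_glInt_holds` — `(GL_n(F), GL_n(𝒪_F))` is a Gelfand pair, i.e. the
  Hecke algebra `ℋ(GL_n(F), GL_n(𝒪_F)) = End_G(ℂ[G ⧸ K₀])` (`heckeAlgebra`, `IsGelfandPair` of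
  module `HeckeAlgebra`) is commutative: `SatakeParametersGL.isGelfandPair_glInt_holds` of
  `SatakeParametersGLGelfandPairProofs` (Gelfand's trick with the transpose and the Cartan
  decomposition; Cartier, Corvallis 1979, §IV.1; Bump (1997), Thm. 4.6.1).
* `PAdicReps.existsUnique_isSatakeParameter_holds` — an irreducible admissible unramified
  representation of `GL_n(F)` has a unique multiset of Satake parameters:
  `SatakeParametersGL.existsUnique_isSatakeParameter_holds` of `SatakeParametersGLProofs`
  (multiplicity one for spherical vectors and Vieta; Cartier, Corvallis 1979, §IV.4; Bump (1997),
  Thm. 4.6.2).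

* `PAdicReps.satake_gl_holds` — the **Satake isomorphism for `GL_n`**: the spherical Hecke algebra
  is isomorphic as a `ℂ`-algebra to `ℂ[e_1, …, e_n][e_n⁻¹]` (`symmLaurent n`):
  `SatakeParametersGL.satake_gl_holds` of `SatakeParametersGLIsoProofs` (the map
  `e_r ↦ q^{r(r-1)/2} T_r`, well defined by commutativity and the fundamental theorem of symmetric
  polynomials, is injective because the Satake transform `satakeTransform` of `SatakeTransformGL`
  inverts it, and surjective by a dimension count over the determinant grading with the Cartan
  decomposition; Satake 1963; Cartier, Corvallis 1979, Thm. 4.1 and §IV.2, Example; Getz–Hahn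
  (2024), Thm. 7.2.1 with (7.1)).
* `PAdicReps.satakeIsomorphismStatement_gl_holds` — the general Satake statement
  `SatakeIsomorphismStatement (ConnectedReductiveGroupData.gl n F) (glInt n F)` of
  `ReductiveGroupData` (`K` hyperspecial ⇒ `ℋ(G(F), K) ≃ₐ[ℂ] ℂ[X_*(A)]^W`) for the datum `GL_n / F`
  and `K = GL_n(𝒪_F)`: the proved glue `SatakeParametersGL.satakeIsomorphismStatement_gl` applied
  to `SatakeParametersGL.satake_gl_holds` and to `symmLaurent_equiv_weylInvariants_holds`
  (`ℂ[e_1, …, e_n][e_n⁻¹] ≃ₐ[ℂ] ℂ[ℤⁿ]^{S_n}`, `SymmLaurentWeylInvariants`); Cartier, Corvallis 1979,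
  Thm. 4.1.

## References

* P. Cartier, *Representations of 𝔭-adic groups: a survey*, Proc. Sympos. Pure Math. 33 (1979),
  part 1, §IV.1, §IV.2 (Thm. 4.1 and Example), §IV.4 [CartierCorvallis1979].
* I. Satake, *Theory of spherical functions on reductive algebraic groups over 𝔭-adic fields*,
  Publ. Math. IHÉS 18 (1963) [Satake1963].
* D. Bump, *Automorphic Forms and Representations* (1997), Thm. 4.6.1, Thm. 4.6.2 [Bump1997].
* J. R. Getz, H. Hahn, *An Introduction to Automorphic Representations*, GTM 300 (2024), §7.2,
  Thm. 7.2.1 and (7.1) (read: held copy, p. 129) [GetzHahn2024].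
-/

noncomputable section

open scoped MatrixGroups
open Matrix ValuativeRel

namespace Literature.NumberTheory.Automorphic

universe u

variable {F : Type u} [Field F] [ValuativeRel F] [TopologicalSpace F] [IsNonarchimedeanLocalField F]

section GelfandPair

variable (n : ℕ) (F)

/-- **lang.S17, Gelfand pair** (discharge of the named fact `PAdicReps.isGelfandPair_glInt`):
`(GL_n(F), GL_n(𝒪_F))` is a Gelfand pair — the Hecke algebra
`ℋ(GL_n(F), GL_n(𝒪_F)) = End_G(ℂ[G ⧸ K₀])` is commutative.  The fact is literally
`SatakeParametersGL.isGelfandPair_glInt n F`, discharged in `SatakeParametersGLGelfandPairProofs`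
by Gelfand's trick for the transpose (an anti-involution of `GL_n(F)` preserving `GL_n(𝒪_F)` and
fixing every double coset, by the Cartan decomposition).  Cartier, *Representations of 𝔭-adic
groups: a survey*, Corvallis 1979, §IV.1; Bump, *Automorphic Forms and Representations* (1997),
Thm. 4.6.1. [cite: CartierCorvallis1979, §IV.1] -/
theorem PAdicReps.isGelfandPair_glInt_holds : PAdicReps.isGelfandPair_glInt F n :=
  SatakeParametersGL.isGelfandPair_glInt_holds n F

end GelfandPair

section SatakeParameters

variable {n : ℕ} {V : Type*} [AddCommGroup V] [Module ℂ V] (ρ : Representation ℂ (GL (Fin n) F) V)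

/-- **lang.S17, existence and uniqueness of Satake parameters** (discharge of the named fact
`PAdicReps.existsUnique_isSatakeParameter`): an irreducible admissible unramified representation
`ρ` of `GL_n(F)` has, with respect to any uniformizer `ϖ`, a unique multiset `α` of Satake
parameters (`IsSatakeParameter ρ ϖ α` of `SatakeParametersGL`), i.e. corresponds to a unique
semisimple conjugacy class `diag(α)` in `GL_n(ℂ)`.  The fact is literally
`SatakeParametersGL.existsUnique_isSatakeParameter ρ`, discharged in `SatakeParametersGLProofs`
(multiplicity one `dim V^{K₀} ≤ 1` from the commutativity of the Hecke operators, then Vieta's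
formulas).  Cartier, *Representations of 𝔭-adic groups: a survey*, Corvallis 1979, §IV.4; Bump
(1997), Thm. 4.6.2 and (6.1). [cite: CartierCorvallis1979, §IV.4] -/
theorem PAdicReps.existsUnique_isSatakeParameter_holds :
    PAdicReps.existsUnique_isSatakeParameter ρ :=
  SatakeParametersGL.existsUnique_isSatakeParameter_holds ρ

end SatakeParameters

section Satake

variable (n : ℕ) (F)

/-- **lang.S17, Satake isomorphism for `GL_n`** (discharge of the named fact `PAdicReps.satake_gl`):
the spherical Hecke algebra `ℋ(GL_n(F), GL_n(𝒪_F)) = End_G(ℂ[G ⧸ K₀])` is isomorphic as a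
`ℂ`-algebra to `ℂ[e_1, …, e_n][e_n⁻¹] = ℂ[x_1^{±1}, …, x_n^{±1}]^{S_n}` (`symmLaurent n`).  The fact
is literally `SatakeParametersGL.satake_gl n F`, discharged in `SatakeParametersGLIsoProofs`
(`SatakeGL.satakeAlgEquiv`: `e_r ↦ q^{r(r-1)/2} T_r`, well defined by the commutativity of the Hecke
algebra and the fundamental theorem of symmetric polynomials, injective because the Satake
transform `satakeTransform` of `SatakeTransformGL` inverts it, surjective by a dimension count
over the determinant grading with the Cartan decomposition; Satake, Publ. Math. IHÉS 18 (1963);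
Cartier, *Representations of 𝔭-adic groups: a survey*, Corvallis 1979, Thm. 4.1 and §IV.2,
Example; Getz–Hahn (2024), Thm. 7.2.1 with (7.1)). [cite: CartierCorvallis1979, Thm. 4.1] -/
theorem PAdicReps.satake_gl_holds : PAdicReps.satake_gl F n :=
  SatakeParametersGL.satake_gl_holds n F

/-- **lang.S17, the general Satake statement for the datum `GL_n / F`** (discharge of the named
fact `PAdicReps.satakeIsomorphismStatement_gl`, i.e. of
`SatakeIsomorphismStatement (ConnectedReductiveGroupData.gl n F) (glInt n F)` of
`ReductiveGroupData`): for the hyperspecial subgroup `K₀ = GL_n(𝒪_F)`,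
`ℋ(GL_n(F), K₀) ≃ₐ[ℂ] ℂ[X_*(A)]^W = ℂ[ℤⁿ]^{S_n}` (`weylInvariants ℂ (Fin n → ℤ) (glWeylGroup n)`).
It is the proved glue `SatakeParametersGL.satakeIsomorphismStatement_gl` applied to the two
discharges `SatakeParametersGL.satake_gl_holds` (`ℋ ≃ₐ ℂ[e_1, …, e_n][e_n⁻¹]`) and
`symmLaurent_equiv_weylInvariants_holds` (`ℂ[e_1, …, e_n][e_n⁻¹] ≃ₐ ℂ[ℤⁿ]^{S_n}`,
`SymmLaurentWeylInvariants`).  Satake, Publ. Math. IHÉS 18 (1963); Cartier, Corvallis 1979,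
Thm. 4.1 (`K` hyperspecial ⇒ `ℋ(G, K) ≅ ℂ[X_*(A)]^W`) and §IV.2, Example `GL_n`; Getz–Hahn
(2024), Thm. 7.2.1. [cite: CartierCorvallis1979, Thm. 4.1] -/
theorem PAdicReps.satakeIsomorphismStatement_gl_holds :
    PAdicReps.satakeIsomorphismStatement_gl F n :=
  SatakeParametersGL.satakeIsomorphismStatement_gl n F (SatakeParametersGL.satake_gl_holds n F)
    (symmLaurent_equiv_weylInvariants_holds n)

end Satake

end Literature.NumberTheory.Automorphic
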